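import Summits.AtomisticToContinuum.FouriersLaw.Theorems.PhononMeanFreePathIncoherentChannelPowerCovLightCone
import Summits.AtomisticToContinuum.FouriersLaw.Theorems.PhononMeanFreePathIncoherentChannelPostCone
import Summits.AtomisticToContinuum.FouriersLaw.Theorems.PhononMeanFreePathIncoherentChannelPostConeKubo

/-!
# Post-cone normal forms of the crux `IncoherentChannel` and of the conjunct `FouriersLaw` — unconditional

Line `two-horizons-forecast-loss` of crux stmt-AtomisticToContinuum-11811
(`Summit.AtomisticToContinuum.FouriersLaw.Theses.PhononMeanFreePath.IncoherentChannel`), lead c9: the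
four-point light cone `powerCov_lightCone` (p164119) DISCHARGES the hypothesis `hC` of the two conditional
files `…IncoherentChannelPostCone` (p163616) and `…IncoherentChannelPostConeKubo` (p163851). This file records
the resulting UNCONDITIONAL statements, importable by every route of `FouriersLaw` that works with the
boundary Kubo form `N·G_N`, `G_N = (γ²/T²)∫₀^∞ Cov_{μ₀}(p₀², K_t p_N²) dt`:

* `powerCovLightCone_pos` — the light cone at strictly positive parameters, in the hypothesis shape `hC`;
* `lightConePiece` — for every `η ∈ (0,1)`: `N(γ²/T²)∫_{(0,N^η]}(C_N − 2r_N²) → 0` (piece 1 of the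
  time-window split of the crux: the causal window carries nothing);
* `preCone_conductance_tendsto_zero` — `N(γ²/T²)∫_{(0,N^η]} C_N → 0`: the two-terminal conductance has no
  pre-causal part;
* `incoherentChannel_iff_postCone` — `IncoherentChannel ↔ ∀ params, ∃ κ > 0, N(γ²/T²)∫_{(N^η,∞)}(C_N − 2r_N²) → κ`;
* `fouriersLaw_iff_postConeKubo` — `FouriersLaw ↔ ∀ params, ∃ κ > 0, N(γ²/T²)∫_{(N^η,∞)} C_N → κ`.

All mass of the Kubo sequence and of the crux sequence sits at times `t > N^η`, for every `η < 1`; what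
remains open is the diffusive window and the tail. No definition, no `sorry`, standard axioms.
-/

noncomputable section

namespace Summit.AtomisticToContinuum.FouriersLaw.Theorems.PhononMeanFreePath

open MeasureTheory Set Filter Topology
open scoped NNReal
open Literature.MathematicalPhysics.KineticTheory.HeatConduction
open Summit.AtomisticToContinuum.FouriersLaw.Theses.PhononMeanFreePath (IncoherentChannel)

/-- The four-point light cone at the crux's strictly positive parameters, in the hypothesis shape `hC` of the
post-cone files (`powerCov_lightCone` holds more generally for `lam, β, γ ≥ 0`). [folklore] -/
theorem powerCovLightCone_pos :
    ∀ ω₂ lam β γ : ℝ, 0 < ω₂ → 0 < lam → 0 < β → 0 < γ → ∀ T : ℝ, 0 < T → ∀ η : ℝ, 0 < η → η < 1 →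
      ∃ ε : ℕ → ℝ, Tendsto (fun N : ℕ => (N : ℝ) ^ (1 + η) * ε N) atTop (𝓝 0) ∧
        ∀ (N : ℕ) (t : ℝ), 0 ≤ t → t ≤ (N : ℝ) ^ η → |powerCov ω₂ lam β γ T N t| ≤ ε N :=
  fun ω₂ lam β γ hω hl hβ hγ T hT η hη hη1 => powerCov_lightCone ω₂ lam β γ hω hl.le hβ.le hγ.le T hT η hη hη1

/-- **The causal window of the crux integrand carries nothing** (unconditional): for every `η ∈ (0,1)` and all
parameters `> 0`, `N(γ²/T²)∫_{(0,N^η]}(C_N − 2r_N²) → 0`. [folklore] -/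
theorem lightConePiece {η : ℝ} (hη : 0 < η) (hη1 : η < 1) :
    ∀ ω₂ lam β γ : ℝ, 0 < ω₂ → 0 < lam → 0 < β → 0 < γ → ∀ T : ℝ, 0 < T →
      Tendsto (fun N : ℕ => (N : ℝ) * (γ ^ 2 / T ^ 2) *
        ∫ t in Ioc (0 : ℝ) ((N : ℝ) ^ η), (powerCov ω₂ lam β γ T N t - 2 * (pairCorr ω₂ lam β γ T N t) ^ 2))
        atTop (𝓝 0) :=
  lightConePiece_of_powerCovLightCone powerCovLightCone_pos hη hη1

/-- **The two-terminal conductance has no pre-causal part** (unconditional): for every `η ∈ (0,1)` and all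
parameters `> 0`, `N(γ²/T²)∫_{(0,N^η]} C_N → 0`. [folklore] -/
theorem preCone_conductance_tendsto_zero {η : ℝ} (hη : 0 < η) (hη1 : η < 1) :
    ∀ ω₂ lam β γ : ℝ, 0 < ω₂ → 0 < lam → 0 < β → 0 < γ → ∀ T : ℝ, 0 < T →
      Tendsto (fun N : ℕ => (N : ℝ) * (γ ^ 2 / T ^ 2) *
        ∫ t in Ioc (0 : ℝ) ((N : ℝ) ^ η), powerCov ω₂ lam β γ T N t) atTop (𝓝 0) :=
  preCone_conductance_tendsto_zero_of_powerCovLightCone powerCovLightCone_pos hη hη1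

/-- **Post-cone normal form of the crux** (unconditional): for every `η ∈ (0,1)`,
`IncoherentChannel ↔ ∀ params > 0, ∃ κ > 0, N(γ²/T²)∫_{(N^η,∞)}(C_N − 2r_N²) → κ`. [folklore] -/
theorem incoherentChannel_iff_postCone : ∀ {η : ℝ}, 0 < η → η < 1 → (IncoherentChannel ↔ ∀ ω₂ lam β γ : ℝ, 0 < ω₂ → 0 < lam → 0 < β → 0 < γ → ∀ T : ℝ, 0 < T → ∃ κ : ℝ, 0 < κ ∧ Tendsto (fun N : ℕ => (N : ℝ) * (γ ^ 2 / T ^ 2) * ∫ t in Ioi ((N : ℝ) ^ η), (powerCov ω₂ lam β γ T N t - 2 * (pairCorr ω₂ lam β γ T N t) ^ 2)) atTop (𝓝 κ)) :=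
  fun hη hη1 => incoherentChannel_iff_postCone_of_powerCovLightCone powerCovLightCone_pos hη hη1

/-- **Post-cone Kubo form of the conjunct** (unconditional): for every `η ∈ (0,1)`,
`FouriersLaw ↔ ∀ params > 0, ∃ κ > 0, N(γ²/T²)∫_{(N^η,∞)} C_N → κ`. [folklore] -/
theorem fouriersLaw_iff_postConeKubo {η : ℝ} (hη : 0 < η) (hη1 : η < 1) :
    _root_.FouriersLaw ↔
      ∀ ω₂ lam β γ : ℝ, 0 < ω₂ → 0 < lam → 0 < β → 0 < γ → ∀ T : ℝ, 0 < T →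
        ∃ κ : ℝ, 0 < κ ∧ Tendsto (fun N : ℕ => (N : ℝ) * (γ ^ 2 / T ^ 2) *
          ∫ t in Ioi ((N : ℝ) ^ η), powerCov ω₂ lam β γ T N t) atTop (𝓝 κ) :=
  fouriersLaw_iff_postConeKubo_of_powerCovLightCone powerCovLightCone_pos hη hη1

end Summit.AtomisticToContinuum.FouriersLaw.Theorems.PhononMeanFreePath

end
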